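import Summits.Ventures.PercRepro.S2DirectCell
import Summits.Ventures.PercRepro.S2FlatSharp
import Summits.Ventures.PercRepro.S2TailFlats
import Summits.Ventures.PercRepro.S2ThirteenSixSpreadNine
import Summits.Ventures.PercRepro.RankLevelSetPlaneTenPrime
import Summits.Ventures.PercRepro.S2ElevenEightK2NuSix

/-!
# PercRepro — S2: THE KEY CELLS `(13, d)`, `43 ≤ d ≤ 49` — THE ROW `p = 13` WITHOUT SUB-CELLS (p7, gen 19; sub-claim S2)

For each corank `d` here, `RLS M 13 5` on every `e`-free core of rank `13` on `13 + d` points (coloops allowed, no coloop split): the flat-sharp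
lever `topCount_le_flat_sharp` at the universal core bounds `(19, 10)` on the plain caps `cq3 d / avgChain16 d / avgChain5b d`, the tail by flats
at `(19, 10)`, and the KEY inequality `Φ(13, 5)·U + A ≤ Σ_{s=6}^{12} C(n, s)` (`c025_core_five_cell_key`, S2DirectCell) — one numeral per cell
(ratios `0.216`, `0.194`, `0.174`, `0.157`, `0.142`, `0.128`, `0.116`). Below `d = 31` the key cell fails (`1.07` at `d = 30`); from `d = 50` the big core S2CoreThirteen takes
over. Nothing about the window is claimed. Axioms: standard.
-/

open scoped Matroid

namespace PercRepro

namespace ThmN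

open Set

variable {α : Type}

set_option maxRecDepth 8192 in
/-- **The key cell `(13, 43)`**: `RLS M 13 5` on every `e`-free core of rank `13` on `56` points (caps `946 / 26488 / 865192`; `#U ≤ 121815136433694211577378 / 21502870163775`,
`#{r ≤ 5} ≤ 2597370962160850878754 / 457507875825`, `Σ_{s=6}^{12} C(56, s) = 752153422371`; ratio `0.216`). -/
theorem c025_thirteen_key_43 (M : Matroid α) [M.Finite]
    (hR : M.eRank = ((13 : ℕ) : ℕ∞)) (hn : M.E.ncard = 13 + 43)
    (hfree : ∀ e ∈ M.E, ∃ A ⊆ M.E \ {e}, e ∉ M.closure A ∧ e ∉ M.closure ((M.E \ {e}) \ A)) : RLS M 13 5 := by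
  classical
  have hd : M.E.encard = M.eRank + ((43 : ℕ) : ℕ∞) := by
    rw [hR, ← M.ground_finite.cast_ncard_eq, hn]
    push_cast
    ring
  have hs3 := TriangleCap.core_ncard_triangles_le_cq3 M hfree hd
  rw [show TriangleCap.cq3 43 = 946 by decide] at hs3
  have hs4 := ncard_fourCircuits_le_avgChain16 43 M hfree hd
  rw [show avgChain16 43 = 26488 by decide] at hs4
  have hs5 := S1.ncard_fiveCircuits_le_avgChain5b 43 M hfree hd
  rw [show S1.avgChain5b 43 = 865192 by decide] at hs5
  have hflat : ∀ X ⊆ M.E, M.eRk X ≤ 5 → X.ncard ≤ 19 := fun X hX hr => ncard_le_nineteen_of_eRk_le_five_of_free M hfree hX hr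
  have hflat' : ∀ X ⊆ M.E, M.eRk X ≤ 4 → X.ncard ≤ 10 := fun X hX hr => ncard_le_ten_of_eRk_le_four_of_free M hfree hX hr
  have hU := topCount_le_flat_sharp M 13 43 (by norm_num) (by norm_num) hR hn hfree 19 10 hflat hflat' (by norm_num) (by norm_num)
    946 26488 865192 hs3 hs4 hs5
  have hA := ncard_eRk_le_five_le_flats M 13 43 (by norm_num) hR hn hfree 19 10 hflat hflat' (by norm_num) (by norm_num)
    (by norm_num) (by norm_num) 946 26488 865192 hs3 hs4 hs5
  rw [RLS_iff]
  refine c025_core_five_cell_key M 13 43 hn _ hU _ hA (phiK 13 5) (by rw [phiK_thirteen_five]; norm_num) ?_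
  rw [phiK_thirteen_five]
  norm_num [Finset.sum_range_succ, Finset.sum_Icc_succ_top, Nat.choose]

set_option maxRecDepth 8192 in
/-- **The key cell `(13, 44)`**: `RLS M 13 5` on every `e`-free core of rank `13` on `57` points (caps `990 / 28842 / 963509`; `#U ≤ 27514349831925831297979 / 4300574032755`,
`#{r ≤ 5} ≤ 55143586089228845480383 / 8601148065510`, `Σ_{s=6}^{12} C(57, s) = 945927357258`; ratio `0.194`). -/
theorem c025_thirteen_key_44 (M : Matroid α) [M.Finite]
    (hR : M.eRank = ((13 : ℕ) : ℕ∞)) (hn : M.E.ncard = 13 + 44)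
    (hfree : ∀ e ∈ M.E, ∃ A ⊆ M.E \ {e}, e ∉ M.closure A ∧ e ∉ M.closure ((M.E \ {e}) \ A)) : RLS M 13 5 := by
  classical
  have hd : M.E.encard = M.eRank + ((44 : ℕ) : ℕ∞) := by
    rw [hR, ← M.ground_finite.cast_ncard_eq, hn]
    push_cast
    ring
  have hs3 := TriangleCap.core_ncard_triangles_le_cq3 M hfree hd
  rw [show TriangleCap.cq3 44 = 990 by decide] at hs3
  have hs4 := ncard_fourCircuits_le_avgChain16 44 M hfree hd
  rw [show avgChain16 44 = 28842 by decide] at hs4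
  have hs5 := S1.ncard_fiveCircuits_le_avgChain5b 44 M hfree hd
  rw [show S1.avgChain5b 44 = 963509 by decide] at hs5
  have hflat : ∀ X ⊆ M.E, M.eRk X ≤ 5 → X.ncard ≤ 19 := fun X hX hr => ncard_le_nineteen_of_eRk_le_five_of_free M hfree hX hr
  have hflat' : ∀ X ⊆ M.E, M.eRk X ≤ 4 → X.ncard ≤ 10 := fun X hX hr => ncard_le_ten_of_eRk_le_four_of_free M hfree hX hr
  have hU := topCount_le_flat_sharp M 13 44 (by norm_num) (by norm_num) hR hn hfree 19 10 hflat hflat' (by norm_num) (by norm_num)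
    990 28842 963509 hs3 hs4 hs5
  have hA := ncard_eRk_le_five_le_flats M 13 44 (by norm_num) hR hn hfree 19 10 hflat hflat' (by norm_num) (by norm_num)
    (by norm_num) (by norm_num) 990 28842 963509 hs3 hs4 hs5
  rw [RLS_iff]
  refine c025_core_five_cell_key M 13 44 hn _ hU _ hA (phiK 13 5) (by rw [phiK_thirteen_five]; norm_num) ?_
  rw [phiK_thirteen_five]
  norm_num [Finset.sum_range_succ, Finset.sum_Icc_succ_top, Nat.choose]

set_option maxRecDepth 8192 in
/-- **The key cell `(13, 45)`**: `RLS M 13 5` on every `e`-free core of rank `13` on `58` points (caps `1035 / 31350 / 1070565`; `#U ≤ 10332813293423778425698 / 1433524677585`,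
`#{r ≤ 5} ≤ 10353822981270773087513 / 1433524677585`, `Σ_{s=6}^{12} C(58, s) = 1184573379042`; ratio `0.174`). -/
theorem c025_thirteen_key_45 (M : Matroid α) [M.Finite]
    (hR : M.eRank = ((13 : ℕ) : ℕ∞)) (hn : M.E.ncard = 13 + 45)
    (hfree : ∀ e ∈ M.E, ∃ A ⊆ M.E \ {e}, e ∉ M.closure A ∧ e ∉ M.closure ((M.E \ {e}) \ A)) : RLS M 13 5 := by
  classical
  have hd : M.E.encard = M.eRank + ((45 : ℕ) : ℕ∞) := by
    rw [hR, ← M.ground_finite.cast_ncard_eq, hn]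
    push_cast
    ring
  have hs3 := TriangleCap.core_ncard_triangles_le_cq3 M hfree hd
  rw [show TriangleCap.cq3 45 = 1035 by decide] at hs3
  have hs4 := ncard_fourCircuits_le_avgChain16 45 M hfree hd
  rw [show avgChain16 45 = 31350 by decide] at hs4
  have hs5 := S1.ncard_fiveCircuits_le_avgChain5b 45 M hfree hd
  rw [show S1.avgChain5b 45 = 1070565 by decide] at hs5
  have hflat : ∀ X ⊆ M.E, M.eRk X ≤ 5 → X.ncard ≤ 19 := fun X hX hr => ncard_le_nineteen_of_eRk_le_five_of_free M hfree hX hr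
  have hflat' : ∀ X ⊆ M.E, M.eRk X ≤ 4 → X.ncard ≤ 10 := fun X hX hr => ncard_le_ten_of_eRk_le_four_of_free M hfree hX hr
  have hU := topCount_le_flat_sharp M 13 45 (by norm_num) (by norm_num) hR hn hfree 19 10 hflat hflat' (by norm_num) (by norm_num)
    1035 31350 1070565 hs3 hs4 hs5
  have hA := ncard_eRk_le_five_le_flats M 13 45 (by norm_num) hR hn hfree 19 10 hflat hflat' (by norm_num) (by norm_num)
    (by norm_num) (by norm_num) 1035 31350 1070565 hs3 hs4 hs5
  rw [RLS_iff]
  refine c025_core_five_cell_key M 13 45 hn _ hU _ hA (phiK 13 5) (by rw [phiK_thirteen_five]; norm_num) ?_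
  rw [phiK_thirteen_five]
  norm_num [Finset.sum_range_succ, Finset.sum_Icc_succ_top, Nat.choose]

set_option maxRecDepth 8192 in
/-- **The key cell `(13, 46)`**: `RLS M 13 5` on every `e`-free core of rank `13` on `59` points (caps `1081 / 34018 / 1186930`; `#U ≤ 69685331264362840313887 / 8601148065510`,
`#{r ≤ 5} ≤ 69823410896145463784827 / 8601148065510`, `Σ_{s=6}^{12} C(59, s) = 1477356550860`; ratio `0.157`). -/
theorem c025_thirteen_key_46 (M : Matroid α) [M.Finite]
    (hR : M.eRank = ((13 : ℕ) : ℕ∞)) (hn : M.E.ncard = 13 + 46)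
    (hfree : ∀ e ∈ M.E, ∃ A ⊆ M.E \ {e}, e ∉ M.closure A ∧ e ∉ M.closure ((M.E \ {e}) \ A)) : RLS M 13 5 := by
  classical
  have hd : M.E.encard = M.eRank + ((46 : ℕ) : ℕ∞) := by
    rw [hR, ← M.ground_finite.cast_ncard_eq, hn]
    push_cast
    ring
  have hs3 := TriangleCap.core_ncard_triangles_le_cq3 M hfree hd
  rw [show TriangleCap.cq3 46 = 1081 by decide] at hs3
  have hs4 := ncard_fourCircuits_le_avgChain16 46 M hfree hd
  rw [show avgChain16 46 = 34018 by decide] at hs4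
  have hs5 := S1.ncard_fiveCircuits_le_avgChain5b 46 M hfree hd
  rw [show S1.avgChain5b 46 = 1186930 by decide] at hs5
  have hflat : ∀ X ⊆ M.E, M.eRk X ≤ 5 → X.ncard ≤ 19 := fun X hX hr => ncard_le_nineteen_of_eRk_le_five_of_free M hfree hX hr
  have hflat' : ∀ X ⊆ M.E, M.eRk X ≤ 4 → X.ncard ≤ 10 := fun X hX hr => ncard_le_ten_of_eRk_le_four_of_free M hfree hX hr
  have hU := topCount_le_flat_sharp M 13 46 (by norm_num) (by norm_num) hR hn hfree 19 10 hflat hflat' (by norm_num) (by norm_num)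
    1081 34018 1186930 hs3 hs4 hs5
  have hA := ncard_eRk_le_five_le_flats M 13 46 (by norm_num) hR hn hfree 19 10 hflat hflat' (by norm_num) (by norm_num)
    (by norm_num) (by norm_num) 1081 34018 1186930 hs3 hs4 hs5
  rw [RLS_iff]
  refine c025_core_five_cell_key M 13 46 hn _ hU _ hA (phiK 13 5) (by rw [phiK_thirteen_five]; norm_num) ?_
  rw [phiK_thirteen_five]
  norm_num [Finset.sum_range_succ, Finset.sum_Icc_succ_top, Nat.choose]

set_option maxRecDepth 8192 in
/-- **The key cell `(13, 47)`**: `RLS M 13 5` on every `e`-free core of rank `13` on `60` points (caps `1128 / 36852 / 1313199`; `#U ≤ 31260807264740402071735 / 3440459226204`,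
`#{r ≤ 5} ≤ 156606031150114897728437 / 17202296131020`, `Σ_{s=6}^{12} C(60, s) = 1835231032126`; ratio `0.142`). -/
theorem c025_thirteen_key_47 (M : Matroid α) [M.Finite]
    (hR : M.eRank = ((13 : ℕ) : ℕ∞)) (hn : M.E.ncard = 13 + 47)
    (hfree : ∀ e ∈ M.E, ∃ A ⊆ M.E \ {e}, e ∉ M.closure A ∧ e ∉ M.closure ((M.E \ {e}) \ A)) : RLS M 13 5 := by
  classical
  have hd : M.E.encard = M.eRank + ((47 : ℕ) : ℕ∞) := by
    rw [hR, ← M.ground_finite.cast_ncard_eq, hn]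
    push_cast
    ring
  have hs3 := TriangleCap.core_ncard_triangles_le_cq3 M hfree hd
  rw [show TriangleCap.cq3 47 = 1128 by decide] at hs3
  have hs4 := ncard_fourCircuits_le_avgChain16 47 M hfree hd
  rw [show avgChain16 47 = 36852 by decide] at hs4
  have hs5 := S1.ncard_fiveCircuits_le_avgChain5b 47 M hfree hd
  rw [show S1.avgChain5b 47 = 1313199 by decide] at hs5
  have hflat : ∀ X ⊆ M.E, M.eRk X ≤ 5 → X.ncard ≤ 19 := fun X hX hr => ncard_le_nineteen_of_eRk_le_five_of_free M hfree hX hr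
  have hflat' : ∀ X ⊆ M.E, M.eRk X ≤ 4 → X.ncard ≤ 10 := fun X hX hr => ncard_le_ten_of_eRk_le_four_of_free M hfree hX hr
  have hU := topCount_le_flat_sharp M 13 47 (by norm_num) (by norm_num) hR hn hfree 19 10 hflat hflat' (by norm_num) (by norm_num)
    1128 36852 1313199 hs3 hs4 hs5
  have hA := ncard_eRk_le_five_le_flats M 13 47 (by norm_num) hR hn hfree 19 10 hflat hflat' (by norm_num) (by norm_num)
    (by norm_num) (by norm_num) 1128 36852 1313199 hs3 hs4 hs5
  rw [RLS_iff]
  refine c025_core_five_cell_key M 13 47 hn _ hU _ hA (phiK 13 5) (by rw [phiK_thirteen_five]; norm_num) ?_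
  rw [phiK_thirteen_five]
  norm_num [Finset.sum_range_succ, Finset.sum_Icc_succ_top, Nat.choose]

set_option maxRecDepth 8192 in
/-- **The key cell `(13, 48)`**: `RLS M 13 5` on every `e`-free core of rank `13` on `61` points (caps `1176 / 39860 / 1449990`; `#U ≤ 31235555572799488442713 / 3071838594825`,
`#{r ≤ 5} ≤ 31294434970945052528803 / 3071838594825`, `Σ_{s=6}^{12} C(61, s) = 2271108680789`; ratio `0.128`). -/
theorem c025_thirteen_key_48 (M : Matroid α) [M.Finite]
    (hR : M.eRank = ((13 : ℕ) : ℕ∞)) (hn : M.E.ncard = 13 + 48)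
    (hfree : ∀ e ∈ M.E, ∃ A ⊆ M.E \ {e}, e ∉ M.closure A ∧ e ∉ M.closure ((M.E \ {e}) \ A)) : RLS M 13 5 := by
  classical
  have hd : M.E.encard = M.eRank + ((48 : ℕ) : ℕ∞) := by
    rw [hR, ← M.ground_finite.cast_ncard_eq, hn]
    push_cast
    ring
  have hs3 := TriangleCap.core_ncard_triangles_le_cq3 M hfree hd
  rw [show TriangleCap.cq3 48 = 1176 by decide] at hs3
  have hs4 := ncard_fourCircuits_le_avgChain16 48 M hfree hd
  rw [show avgChain16 48 = 39860 by decide] at hs4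
  have hs5 := S1.ncard_fiveCircuits_le_avgChain5b 48 M hfree hd
  rw [show S1.avgChain5b 48 = 1449990 by decide] at hs5
  have hflat : ∀ X ⊆ M.E, M.eRk X ≤ 5 → X.ncard ≤ 19 := fun X hX hr => ncard_le_nineteen_of_eRk_le_five_of_free M hfree hX hr
  have hflat' : ∀ X ⊆ M.E, M.eRk X ≤ 4 → X.ncard ≤ 10 := fun X hX hr => ncard_le_ten_of_eRk_le_four_of_free M hfree hX hr
  have hU := topCount_le_flat_sharp M 13 48 (by norm_num) (by norm_num) hR hn hfree 19 10 hflat hflat' (by norm_num) (by norm_num)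
    1176 39860 1449990 hs3 hs4 hs5
  have hA := ncard_eRk_le_five_le_flats M 13 48 (by norm_num) hR hn hfree 19 10 hflat hflat' (by norm_num) (by norm_num)
    (by norm_num) (by norm_num) 1176 39860 1449990 hs3 hs4 hs5
  rw [RLS_iff]
  refine c025_core_five_cell_key M 13 48 hn _ hU _ hA (phiK 13 5) (by rw [phiK_thirteen_five]; norm_num) ?_
  rw [phiK_thirteen_five]
  norm_num [Finset.sum_range_succ, Finset.sum_Icc_succ_top, Nat.choose]

set_option maxRecDepth 8192 in
/-- **The key cell `(13, 49)`**: `RLS M 13 5` on every `e`-free core of rank `13` on `62` points (caps `1225 / 43048 / 1597948`; `#U ≤ 13953259921069049736709 / 1228735437930`,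
`#{r ≤ 5} ≤ 6989467381283387893169 / 614367718965`, `Σ_{s=6}^{12} C(62, s) = 2800164340450`; ratio `0.116`). -/
theorem c025_thirteen_key_49 (M : Matroid α) [M.Finite]
    (hR : M.eRank = ((13 : ℕ) : ℕ∞)) (hn : M.E.ncard = 13 + 49)
    (hfree : ∀ e ∈ M.E, ∃ A ⊆ M.E \ {e}, e ∉ M.closure A ∧ e ∉ M.closure ((M.E \ {e}) \ A)) : RLS M 13 5 := by
  classical
  have hd : M.E.encard = M.eRank + ((49 : ℕ) : ℕ∞) := by
    rw [hR, ← M.ground_finite.cast_ncard_eq, hn]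
    push_cast
    ring
  have hs3 := TriangleCap.core_ncard_triangles_le_cq3 M hfree hd
  rw [show TriangleCap.cq3 49 = 1225 by decide] at hs3
  have hs4 := ncard_fourCircuits_le_avgChain16 49 M hfree hd
  rw [show avgChain16 49 = 43048 by decide] at hs4
  have hs5 := S1.ncard_fiveCircuits_le_avgChain5b 49 M hfree hd
  rw [show S1.avgChain5b 49 = 1597948 by decide] at hs5
  have hflat : ∀ X ⊆ M.E, M.eRk X ≤ 5 → X.ncard ≤ 19 := fun X hX hr => ncard_le_nineteen_of_eRk_le_five_of_free M hfree hX hr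
  have hflat' : ∀ X ⊆ M.E, M.eRk X ≤ 4 → X.ncard ≤ 10 := fun X hX hr => ncard_le_ten_of_eRk_le_four_of_free M hfree hX hr
  have hU := topCount_le_flat_sharp M 13 49 (by norm_num) (by norm_num) hR hn hfree 19 10 hflat hflat' (by norm_num) (by norm_num)
    1225 43048 1597948 hs3 hs4 hs5
  have hA := ncard_eRk_le_five_le_flats M 13 49 (by norm_num) hR hn hfree 19 10 hflat hflat' (by norm_num) (by norm_num)
    (by norm_num) (by norm_num) 1225 43048 1597948 hs3 hs4 hs5
  rw [RLS_iff]
  refine c025_core_five_cell_key M 13 49 hn _ hU _ hA (phiK 13 5) (by rw [phiK_thirteen_five]; norm_num) ?_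
  rw [phiK_thirteen_five]
  norm_num [Finset.sum_range_succ, Finset.sum_Icc_succ_top, Nat.choose]


end ThmN

end PercRepro
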